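import Literature.Computability.Cryptography.ComPRGSpec
import Literature.Computability.Cryptography.BindingEntropyGap
import Literature.Computability.Cryptography.IndistinguishabilityRepeatedIndexed
import Literature.Computability.Complexity.BitCodecs
import HarnessLib

/-!
# A pseudorandom generator from a bit-commitment scheme, III: the block model, the good candidate and the hybrids

Topic `Literature/Computability/Cryptography`; sequel of `ComPRGSpec.lean` (M. Luby, *Pseudorandomness and
Cryptographic Applications*, 1996, Lecture 10, Thm. 10.3, over the false-entropy generator `⟨commit(b; r), b⟩` of a
bit-commitment scheme). This file fixes the objects of the security proof at level `n`:

* the **block model**: blocks `Blk n = {0,1}^{L0 n}` (`x = b ‖ r`, the committed bit `bitOf x` and the sender's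
  honest coins `coinsOf x = (r ↾ ρ n)`, `ρ n = coinLenAt n ·` the true, possibly non-computable, coin count),
  the commitment string `Cm n x`, the pair `Fm n = (Cm, bitOf)` and the pair with a fresh bit `Gm n (x, u) = (Cm x, u)`;
* the **good candidate**: the entropy `HC n = H(Cm(U))` of the commitment string, its guess
  `jStar n = ⌊4·HC n⌋` (`jStar/4 ≤ HC < (jStar+1)/4`), and the index `kGood n = idxOf n (ρ n) (jStar n)` — the
  "correct guess" sequence (not computable) at which `XorCombiner.isPseudorandom_xorCombiner` is invoked;
* the **hybrid distributions** of the proof of Thm. 10.3 with the hiding hybrids of its Step 2 built in: on coins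
  `κ₁ ‖ κ₂ ‖ R ‖ u₂` (`R` = `t` blocks of `L0 + 1` bits: a seed block and one fresh bit) the string
  `hybStr n i = κ₁ ‖ κ₂ ‖ (h¹_{κ₁}(z_i(R)) ‖ u₂ ‖ 0…)↾(xLen+1)`, where `z_i` codes the pairs `(commit(bℓ; rℓ), ·)` with
  the FRESH bit in the first `i` positions and the committed bit `bℓ` in the others; `X S i n` is its law
  (`X S 0` is Luby's `⟨h(f'(Y)), R₂, Y', Y''⟩` after Step 1, `X S (t n)` is `⟨h(Z), R₂, Y', Y''⟩` before Step 3);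
* the codecs identifying coin strings with tuples (`cW`: `xLen`-bit seeds `↔ Fin t → Blk`; `cR`: `R ↔ Fin t → Blk × {0,1}`),
  the coded tuple as a function of the tuple of pairs (`zStr_enc`, `zH_enc`, `encT_injOn`), and the acceptance
  probabilities of a distinguisher on the real candidate, on `X S i` and on the uniform string as iterated uniform
  averages (`acc_real`, `acc_X`, `acc_unif`) — the form consumed by the test-form hashing lemmas of
  `LeftoverHashSmooth.lean`.

All proved; no named facts.

## References

* M. Luby, *Pseudorandomness and Cryptographic Applications*, Princeton University Press 1996, Lecture 10,
  Thm. 10.3 (proof, Steps 1–3).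
* O. Goldreich, *Foundations of Cryptography I*, CUP 2001, §3.2.3 (hybrid distributions), Def. 4.4.1.
-/

namespace Literature.Computability.Cryptography

open _root_.Computability Complexity Complexity.Brick Complexity.BitCodec Polynomial Hybrid AffineStr Finset HHRVW
  FalseEntropy RepSampI

namespace ComPRG

namespace Setup

variable (S : Setup)

/-! ### The block model -/

/-- **The honest coin count** `ρ n = coinLenAt n b` (the same for both bits; NOT computable in general).
[cite: Goldreich2001, Def. 4.4.1 (the sender's coins)] -/
def ρ (n : ℕ) : ℕ := S.C.coinLenAt n true

/-- `ρ n = coinLenAt n b` for every bit. [folklore] -/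
theorem ρ_eq (n : ℕ) (b : Bool) : S.ρ n = S.C.coinLenAt n b := S.coinLenAt_eq n true b

/-- `ρ n ≤ J n`. [folklore] -/
theorem ρ_le_J (hS : S.WF) (n : ℕ) : S.ρ n ≤ S.J n := S.coinLenAt_le_J hS n true

/-- The blocks `{0,1}^{L0 n}`. [cite: Luby1996, Lecture 10, Theorem 10.3 (the input `x ∈ {0,1}ⁿ` of `f`)] -/
abbrev Blk (n : ℕ) : Type := List.Vector Bool (S.L0 n)

/-- The committed bit of a block (its first bit). [folklore] -/
def bitOf {n : ℕ} (x : S.Blk n) : Bool := x.toList.headD false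

/-- The sender's coins of a block (the next `ρ n` bits). [folklore] -/
def coinsOf {n : ℕ} (x : S.Blk n) : List Bool := (x.toList.drop 1).take (S.ρ n)

/-- **The commitment string of a block** `commit(1ⁿ, b; r ↾ ρ)`. [cite: Goldreich2001, Def. 4.4.1] -/
def Cm (n : ℕ) (x : S.Blk n) : List Bool := S.comRun n (S.bitOf x) (S.coinsOf x)

/-- **The false-entropy generator** `Fm n x = (commit(b; r), b)`. [cite: Luby1996, Lecture 10 (false entropy generator) and Lecture 13, p. 137] -/
def Fm (n : ℕ) : S.Blk n → List Bool × Bool := pairMap (S.Cm n) S.bitOf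

/-- **The ideal pair** `Gm n (x, u) = (commit(b; r), u)` with a fresh bit `u`. [cite: Luby1996, Lecture 10, Theorem 10.3 (the distribution `𝓔_n`)] -/
def Gm (n : ℕ) (p : S.Blk n × List.Vector Bool 1) : List Bool × Bool := (S.Cm n p.1, p.2.head)

/-- `Gm = Prod.map Cm head`. [folklore] -/
theorem Gm_eq (n : ℕ) : S.Gm n = Prod.map (S.Cm n) List.Vector.head := rfl

/-- `|Blk n| = 2^{L0 n}`. [folklore] -/
theorem card_Blk (n : ℕ) : Fintype.card (S.Blk n) = 2 ^ S.L0 n := by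
  rw [card_vector, Fintype.card_bool]

/-- `1 < |Blk n|`. [folklore] -/
theorem one_lt_card_Blk (n : ℕ) : 1 < Fintype.card (S.Blk n) := by
  rw [card_Blk]; exact Nat.one_lt_two_pow (by have := S.one_le_L0 n; omega)

/-- `log₂ |Blk n| = L0 n`. [folklore] -/
theorem logb_card_Blk (n : ℕ) : Real.logb 2 (Fintype.card (S.Blk n)) = S.L0 n := by
  rw [card_Blk, Nat.cast_pow, Nat.cast_two, Real.logb_pow, Real.logb_self_eq_one (by norm_num), mul_one]

/-- Commitment strings are within the length bound: `|Cm n x| ≤ Qc n`. [folklore] -/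
theorem length_Cm_le (hS : S.WF) (n : ℕ) (x : S.Blk n) : (S.Cm n x).length ≤ S.Qc n := by
  have hρ := S.ρ_le_J hS n
  have h := hS.hQ (boolPair (ones n) (boolPair [S.bitOf x] (S.coinsOf x)))
  have hcom : comB S.C (boolPair (ones n) (boolPair [S.bitOf x] (S.coinsOf x))) = S.Cm n x := by
    simp [comB, Cm, comRun, ones]
  rw [hcom, length_boolPair, length_boolPair, List.length_singleton] at h
  refine h.trans (TM2Iter.eval_mono _ ?_)
  have hc : (S.coinsOf x).length ≤ S.J n := by
    unfold coinsOf; rw [List.length_take]; exact (min_le_left _ _).trans hρ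
  simp only [ones, List.length_replicate]
  omega

/-- `|comRun n b r| ≤ Qc n` for `|r| ≤ J n`. [folklore] -/
theorem length_comRun_le (hS : S.WF) (n : ℕ) (b : Bool) {r : List Bool} (hr : r.length ≤ S.J n) :
    (S.comRun n b r).length ≤ S.Qc n := by
  have h := hS.hQ (boolPair (ones n) (boolPair [b] r))
  have hcom : comB S.C (boolPair (ones n) (boolPair [b] r)) = S.comRun n b r := by simp [comB, comRun, ones]
  rw [hcom, length_boolPair, length_boolPair, List.length_singleton] at h
  refine h.trans (TM2Iter.eval_mono _ ?_)
  simp only [ones, List.length_replicate]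
  omega

/-! ### The good candidate -/

/-- **The entropy of the commitment string** `HC n = H(Cm n (U_{Blk n}))` (bits). [cite: Luby1996, Lecture 10, Theorem 10.3 (`ent(f(X))`)] -/
noncomputable def HC (n : ℕ) : ℝ := mapEntropy univ (S.Cm n)

/-- `0 ≤ HC n`. [folklore] -/
theorem HC_nonneg (n : ℕ) : 0 ≤ S.HC n := by
  unfold HC mapEntropy
  exact div_nonneg (Finset.sum_nonneg fun x _ => logb_card_div_card_fiber_nonneg _ (Finset.mem_univ x)) (by positivity)

/-- `HC n ≤ L0 n`. [folklore] -/
theorem HC_le_L0 (n : ℕ) : S.HC n ≤ S.L0 n := by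
  unfold HC mapEntropy
  have hcard : (0 : ℝ) < (univ : Finset (S.Blk n)).card := by
    rw [Finset.card_univ]; exact_mod_cast Fintype.card_pos
  rw [div_le_iff₀ hcard]
  calc ∑ v : S.Blk n, Real.logb 2 (((univ : Finset (S.Blk n)).card : ℝ) / (fiber univ (S.Cm n) (S.Cm n v)).card)
      ≤ ∑ _v : S.Blk n, (S.L0 n : ℝ) := Finset.sum_le_sum fun v _ =>
        (logb_card_div_card_fiber_le _ (Finset.mem_univ v)).trans (by rw [Finset.card_univ, logb_card_Blk])
    _ = S.L0 n * (univ : Finset (S.Blk n)).card := by rw [Finset.sum_const, nsmul_eq_mul, mul_comm]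

/-- **The entropy guess of the good candidate**: `jStar n = ⌊4·HC n⌋`. [cite: Luby1996, Lecture 10, Theorem 10.3 (`ent(f(X))` in the output lengths)] -/
noncomputable def jStar (n : ℕ) : ℕ := ⌊4 * S.HC n⌋₊

/-- `jStar/4 ≤ HC`. [folklore] -/
theorem jStar_le_HC (n : ℕ) : (S.jStar n : ℝ) / 4 ≤ S.HC n := by
  have h := Nat.floor_le (show 0 ≤ 4 * S.HC n by have := S.HC_nonneg n; positivity)
  unfold jStar; linarith

/-- `HC < (jStar + 1)/4`. [folklore] -/
theorem HC_lt_jStar (n : ℕ) : S.HC n < ((S.jStar n : ℝ) + 1) / 4 := by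
  have h := Nat.lt_floor_add_one (4 * S.HC n)
  unfold jStar; linarith

/-- `jStar n ≤ 4·L0 n`. [folklore] -/
theorem jStar_le (n : ℕ) : S.jStar n ≤ 4 * S.L0 n := by
  have h1 := S.jStar_le_HC n
  have h2 := S.HC_le_L0 n
  have h : (S.jStar n : ℝ) ≤ 4 * S.L0 n := by linarith
  exact_mod_cast h

/-- **The good index**: the pair of guesses `(ρ n, jStar n)`. [cite: HastadImpagliazzoLevinLuby1999, §4 (the correct guess of the enumeration)] -/
noncomputable def kGood (n : ℕ) : ℕ := S.idxOf n (S.ρ n) (S.jStar n)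

/-- The good index is one of the candidates. [folklore] -/
theorem kGood_lt_mCnt (hS : S.WF) (n : ℕ) : S.kGood n < S.mCnt n := S.idxOf_lt_mCnt (S.ρ_le_J hS n) (S.jStar_le n)

/-- `rhoOf n (kGood n) = ρ n`. [folklore] -/
theorem rhoOf_kGood (hS : S.WF) (n : ℕ) : S.rhoOf n (S.kGood n) = S.ρ n := S.rhoOf_idxOf (S.ρ_le_J hS n) _

/-- `jOf n (kGood n) = jStar n`. [folklore] -/
theorem jOf_kGood (hS : S.WF) (n : ℕ) : S.jOf n (S.kGood n) = S.jStar n := S.jOf_idxOf (S.ρ_le_J hS n) _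

/-- `m1S n = m1 n (jStar n)`. [folklore] -/
noncomputable def m1S (n : ℕ) : ℕ := S.m1 n (S.jStar n)

/-- `m2S n = m2 n (jStar n)`. [folklore] -/
noncomputable def m2S (n : ℕ) : ℕ := S.m2 n (S.jStar n)

/-- The good candidate's hash outputs exceed `xLen` together. [folklore] -/
theorem xLen_lt_m1S_add_m2S (n : ℕ) : S.xLen n + 1 ≤ S.m1S n + S.m2S n := S.xLen_lt_m1_add_m2 (S.jStar_le n)

/-- `m1S ≤ M1`. [folklore] -/
theorem m1S_le_M1 (n : ℕ) : S.m1S n ≤ S.M1 n := S.m1_le_M1 (S.jStar_le n)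

/-- `m2S ≤ xLen`. [folklore] -/
theorem m2S_le_xLen (n : ℕ) : S.m2S n ≤ S.xLen n := S.m2_le_xLen n _

/-! ### Codecs: coin strings as tuples -/

/-- Blocks coded by themselves. [folklore] -/
def cB (n : ℕ) : BitCodec (S.Blk n) := BitCodec.vector (S.L0 n)

/-- **The seed blocks**: `xLen`-bit strings as `t`-tuples of blocks. [folklore] -/
def cW (n : ℕ) : BitCodec (Fin (S.t n) → S.Blk n) := BitCodec.pi (S.cB n) (S.t n)

/-- A block with a fresh bit. [folklore] -/
def cBU (n : ℕ) : BitCodec (S.Blk n × List.Vector Bool 1) := BitCodec.prod (S.cB n) (BitCodec.vector 1)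

/-- **The hybrid coins `R`**: `t` blocks of `L0 + 1` bits as `t`-tuples of (block, fresh bit). [folklore] -/
def cR (n : ℕ) : BitCodec (Fin (S.t n) → S.Blk n × List.Vector Bool 1) := BitCodec.pi (S.cBU n) (S.t n)

/-- `rLen n = t·(L0 + 1)`: the length of `R`. [folklore] -/
def rLen (n : ℕ) : ℕ := S.t n * (S.L0 n + 1)

/-- `(cW n).len = xLen n`. [folklore] -/
@[simp] theorem cW_len (n : ℕ) : (S.cW n).len = S.xLen n := rfl

/-- `(cR n).len = rLen n`. [folklore] -/
@[simp] theorem cR_len (n : ℕ) : (S.cR n).len = S.rLen n := rfl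

/-- Block `ℓ` of a coded seed tuple is component `ℓ`. [folklore] -/
theorem blk_cW_enc {n : ℕ} (w : Fin (S.t n) → S.Blk n) (ℓ : Fin (S.t n)) :
    blk (S.L0 n) ℓ ((S.cW n).enc w) = (w ℓ).toList := by
  rw [blk, cW]
  exact pi_enc_block (S.cB n) (S.t n) w ℓ

/-- Block `ℓ` of coded hybrid coins is component `ℓ` (block, then the fresh bit). [folklore] -/
theorem blk_cR_enc {n : ℕ} (w : Fin (S.t n) → S.Blk n × List.Vector Bool 1) (ℓ : Fin (S.t n)) :
    blk (S.L0 n + 1) ℓ ((S.cR n).enc w) = (w ℓ).1.toList ++ (w ℓ).2.toList := by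
  rw [blk, cR]
  exact pi_enc_block (S.cBU n) (S.t n) w ℓ

/-! ### Coded tuples of pairs -/

/-- **The coded tuple of a tuple of pairs**: `encT n z = encP(z₀) ‖ ⋯ ‖ encP(z_{t−1})`. [folklore] -/
def encT (n : ℕ) (z : Fin (S.t n) → List Bool × Bool) : List Bool :=
  ccat (fun ℓ => if h : ℓ < S.t n then S.encP n (z ⟨ℓ, h⟩).1 (z ⟨ℓ, h⟩).2 else []) (S.t n)

/-- `|encT n z| = t·Lz`. [folklore] -/
theorem length_encT (n : ℕ) (z : Fin (S.t n) → List Bool × Bool) : (S.encT n z).length = S.t n * S.Lz n :=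
  length_ccat_blocks fun ℓ hℓ => by rw [dif_pos hℓ, length_encP]

/-- Block `ℓ` of the coded tuple is the coded pair `ℓ`. [folklore] -/
theorem block_encT {n : ℕ} (z : Fin (S.t n) → List Bool × Bool) (ℓ : Fin (S.t n)) :
    ((S.encT n z).drop (ℓ * S.Lz n)).take (S.Lz n) = S.encP n (z ℓ).1 (z ℓ).2 := by
  rw [encT, ccat_block (fun i hi => by rw [dif_pos hi, length_encP]) ℓ.isLt, dif_pos ℓ.isLt]

/-- **The coded tuple is injective on tuples of pairs within the length bound.** [folklore] -/
theorem encT_inj {n : ℕ} {z z' : Fin (S.t n) → List Bool × Bool} (hz : ∀ ℓ, (z ℓ).1.length ≤ S.Qc n)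
    (hz' : ∀ ℓ, (z' ℓ).1.length ≤ S.Qc n) (h : S.encT n z = S.encT n z') : z = z' := by
  funext ℓ
  have hb := S.block_encT z ℓ
  rw [h, S.block_encT z' ℓ] at hb
  obtain ⟨h1, h2⟩ := S.encP_inj (hz' ℓ) (hz ℓ) hb
  exact Prod.ext h1.symm h2.symm

/-- **The candidate's coded tuple on a coded seed is the coded tuple of `Fmᵗ`** (with the honest coin count).
[cite: Luby1996, Lecture 10, Theorem 10.3 (`f'(y) = ⟨f(y₁), …, f(y_{k(n)})⟩`)] -/
theorem zStr_enc {n : ℕ} (w : Fin (S.t n) → S.Blk n) :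
    S.zStr n (S.ρ n) ((S.cW n).enc w) = S.encT n (prodMap (S.Fm n) (S.t n) w) := by
  unfold zStr encT
  refine ccat_congr fun ℓ hℓ => ?_
  rw [dif_pos hℓ, S.blk_cW_enc w ⟨ℓ, hℓ⟩]
  rfl

/-- **The hybrid coded tuple** `z_i(R)`: pair `ℓ` is `(commit(bℓ; rℓ ↾ ρ̃), ·)` with the fresh bit of block `ℓ` for
`ℓ < i` and the committed bit `bℓ` otherwise (`R` = `t` blocks of `L0 + 1` bits).
[cite: Goldreich2001, §3.2.3 (hybrid distributions); Luby1996, Lecture 10, Theorem 10.3 (Step 2)] -/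
def zH (n ρ i : ℕ) (R : List Bool) : List Bool :=
  ccat (fun ℓ =>
    S.encP n (S.comRun n ((blk (S.L0 n + 1) ℓ R).headD false) (((blk (S.L0 n + 1) ℓ R).drop 1).take ρ))
      (if ℓ < i then (blk (S.L0 n + 1) ℓ R).getD (S.L0 n) false else (blk (S.L0 n + 1) ℓ R).headD false)) (S.t n)

/-- The pair at position `ℓ` of hybrid `i` on a tuple of (block, fresh bit). [folklore] -/
def pairH (n i : ℕ) (w : Fin (S.t n) → S.Blk n × List.Vector Bool 1) (ℓ : Fin (S.t n)) : List Bool × Bool :=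
  (S.Cm n (w ℓ).1, if (ℓ : ℕ) < i then (w ℓ).2.head else S.bitOf (w ℓ).1)

/-- Reading a coded (block, fresh bit): head, coins and the fresh bit. [folklore] -/
theorem read_blockU (hS : S.WF) {n : ℕ} (x : S.Blk n) (u : List.Vector Bool 1) :
    (x.toList ++ u.toList).headD false = S.bitOf x ∧
      ((x.toList ++ u.toList).drop 1).take (S.ρ n) = S.coinsOf x ∧
        (x.toList ++ u.toList).getD (S.L0 n) false = u.head := by
  have hx : x.toList.length = S.L0 n := x.toList_length
  have hL : 1 ≤ S.L0 n := S.one_le_L0 n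
  have hρ : S.ρ n ≤ S.J n := S.ρ_le_J hS n
  obtain ⟨l, hl⟩ := x
  obtain ⟨m, hm⟩ := u
  simp only [List.Vector.toList_mk, bitOf, coinsOf, List.Vector.head]
  cases l with
  | nil => simp at hl; omega
  | cons b l' =>
    cases m with
    | nil => simp at hm
    | cons c m' =>
      simp only [List.length_cons] at hl hm
      have hm' : m' = [] := List.eq_nil_of_length_eq_zero (by omega)
      subst hm'
      refine ⟨rfl, ?_, ?_⟩
      · simp only [List.cons_append, List.drop_succ_cons, List.drop_zero]
        rw [List.take_append_of_le_length (by unfold L0 at hl; omega)]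
      · simp only [List.cons_append]
        rw [show b :: (l' ++ [c]) = (b :: l') ++ [c] from rfl,
          List.getD_append_right _ _ _ _ (by simp only [List.length_cons]; omega)]
        have h0 : S.L0 n - (b :: l').length = 0 := by simp only [List.length_cons]; omega
        rw [h0]
        rfl

/-- **The hybrid coded tuple on coded coins is the coded tuple of the hybrid pairs.** [folklore] -/
theorem zH_enc (hS : S.WF) {n : ℕ} (i : ℕ) (w : Fin (S.t n) → S.Blk n × List.Vector Bool 1) :
    S.zH n (S.ρ n) i ((S.cR n).enc w) = S.encT n (S.pairH n i w) := by
  unfold zH encT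
  refine ccat_congr fun ℓ hℓ => ?_
  rw [dif_pos hℓ, S.blk_cR_enc w ⟨ℓ, hℓ⟩]
  obtain ⟨h1, h2, h3⟩ := S.read_blockU hS (w ⟨ℓ, hℓ⟩).1 (w ⟨ℓ, hℓ⟩).2
  rw [h1, h2, h3]
  rfl

/-- Hybrid `0` is the honest tuple `Fmᵗ` of the blocks. [folklore] -/
theorem pairH_zero {n : ℕ} (w : Fin (S.t n) → S.Blk n × List.Vector Bool 1) :
    S.pairH n 0 w = prodMap (S.Fm n) (S.t n) (fun ℓ => (w ℓ).1) := by
  funext ℓ; simp [pairH, prodMap, Fm, pairMap]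

/-- Hybrid `t` is the ideal tuple `Gmᵗ`. [folklore] -/
theorem pairH_t {n : ℕ} (w : Fin (S.t n) → S.Blk n × List.Vector Bool 1) :
    S.pairH n (S.t n) w = prodMap (S.Gm n) (S.t n) w := by
  funext ℓ; simp [pairH, prodMap, Gm, ℓ.isLt]

/-! ### The hybrid strings and their laws -/

/-- The clamped payload `(y₁ ‖ y₂ ‖ 0^{xLen+1}) ↾ (xLen + 1)`. [folklore] -/
def pay (n : ℕ) (y₁ y₂ : List Bool) : List Bool := (y₁ ++ y₂ ++ List.replicate (S.xLen n + 1) false).take (S.xLen n + 1)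

/-- `|pay n y₁ y₂| = xLen n + 1`. [folklore] -/
theorem length_pay (n : ℕ) (y₁ y₂ : List Bool) : (S.pay n y₁ y₂).length = S.xLen n + 1 := by
  simp only [pay, List.length_take, List.length_append, List.length_replicate]; omega

/-- `Lh n = K1 + K2 + rLen + m2S`: the coin length of the hybrids. [folklore] -/
noncomputable def Lh (n : ℕ) : ℕ := S.K1 n + S.K2 n + S.rLen n + S.m2S n

/-- **The hybrid string** `hybStr n i` on coins `κ₁ ‖ κ₂ ‖ R ‖ u₂`: `κ₁ ‖ κ₂ ‖ (h¹_{κ₁}(z_i(R)) ‖ u₂ ‖ 0…)↾(xLen+1)`.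
[cite: Luby1996, Lecture 10, Theorem 10.3 (proof: `⟨h_{Y'}(·), R₂, Y', Y''⟩`); Goldreich2001, §3.2.3] -/
noncomputable def hybStr (n i : ℕ) (c : List Bool) : List Bool :=
  c.take (S.K1 n) ++ ((c.drop (S.K1 n)).take (S.K2 n) ++
    S.pay n (hashStr (S.t n * S.Lz n) (S.m1S n) (c.take (S.K1 n)) (S.zH n (S.ρ n) i ((c.drop (S.K1 n + S.K2 n)).take (S.rLen n))))
      ((c.drop (S.K1 n + S.K2 n + S.rLen n)).take (S.m2S n)))

/-- **The hybrid ensembles** `X S i n`. [cite: Goldreich2001, §3.2.3 (hybrid distributions)] -/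
noncomputable def X (i : ℕ → ℕ) : Ensemble (List Bool) := fun n => (uniformBits (S.Lh n)).map (S.hybStr n (i n))

/-- `|hybStr n i c| = a n + 1` on coins of length `Lh n`. [folklore] -/
theorem length_hybStr (n i : ℕ) {c : List Bool} (hc : c.length = S.Lh n) : (S.hybStr n i c).length = S.a n + 1 := by
  simp only [hybStr, List.length_append, List.length_take, List.length_drop, length_pay, hc]
  unfold Lh a
  omega

/-- Every sample of `X S i n` has length `a n + 1`. [folklore] -/
theorem length_of_mem_X (i : ℕ → ℕ) (n : ℕ) {y : List Bool} (hy : y ∈ (S.X i n).support) : y.length = S.a n + 1 := by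
  unfold X at hy
  rw [PMF.mem_support_map_iff] at hy
  obtain ⟨c, hc, rfl⟩ := hy
  exact S.length_hybStr n _ (PRGTrunc.length_eq_of_mem_support_uniformBits hc)

/-! ### Acceptance probabilities as iterated uniform averages -/

/-- **The test of a distinguisher**: `T D n y = Pr[D(1ⁿ, y) = 1]`. [cite: Goldreich2001, Def. 3.2.2] -/
noncomputable def T (D : RandAlg (List Bool) Bool) (n : ℕ) (y : List Bool) : ℝ :=
  (D.outputPMF id (boolPair (unaryEncodeNat n) y) true).toReal

/-- `0 ≤ T ≤ 1`. [folklore] -/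
theorem T_mem (D : RandAlg (List Bool) Bool) (n : ℕ) (y : List Bool) : 0 ≤ T D n y ∧ T D n y ≤ 1 :=
  ⟨ENNReal.toReal_nonneg, ENNReal.toReal_le_of_le_ofReal zero_le_one (by rw [ENNReal.ofReal_one]; exact PMF.coe_le_one _ _)⟩

variable {S}

/-- Three-way split of a uniform average along `a + b + c` bits. [folklore] -/
theorem uniformAvg_append3 (a b c : ℕ) (F : List Bool → ℝ) :
    uniformAvg (a + b + c) F = uniformAvg a fun u => uniformAvg b fun v => uniformAvg c fun w => F (u ++ v ++ w) := by
  rw [uniformAvg_append (a + b) c, uniformAvg_append a b]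

/-- Four-way split of a uniform average. [folklore] -/
theorem uniformAvg_append4 (a b c d : ℕ) (F : List Bool → ℝ) :
    uniformAvg (a + b + c + d) F =
      uniformAvg a fun u => uniformAvg b fun v => uniformAvg c fun w => uniformAvg d fun x => F (u ++ v ++ w ++ x) := by
  rw [uniformAvg_append (a + b + c) d, uniformAvg_append3]

/-- Parsing `u ++ v ++ w` (`|u| = a`, `|v| = b`). [folklore] -/
theorem parse3 {u v w : List Bool} {a b : ℕ} (hu : u.length = a) (hv : v.length = b) :
    (u ++ v ++ w).take a = u ∧ ((u ++ v ++ w).drop a).take b = v ∧ (u ++ v ++ w).drop (a + b) = w := by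
  subst hu; subst hv
  refine ⟨?_, ?_, ?_⟩
  · rw [List.append_assoc, List.take_append_of_le_length le_rfl, List.take_length]
  · rw [List.append_assoc, List.drop_append_of_le_length le_rfl, List.drop_length, List.nil_append,
      List.take_append_of_le_length le_rfl, List.take_length]
  · rw [← List.length_append, List.drop_left]

variable (S)

/-- **The real candidate's acceptance probability** as an average over keys and seed blocks:
`Pr[D(1ⁿ, cand(U_a)) = 1] = E_{κ₁} E_{κ₂} E_{x} T(κ₁ ‖ κ₂ ‖ pay(h¹_{κ₁}(zStr x), h²_{κ₂}(x)))`.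
[cite: Luby1996, Lecture 10, Theorem 10.3 (`g(Y, Y', Y'')`)] -/
theorem acc_real (hS : S.WF) (D : RandAlg (List Bool) Bool) (n : ℕ) :
    (acceptPMF D n (seedEnsembleI S.candI S.aP S.kGood n) true).toReal =
      uniformAvg (S.K1 n) fun κ₁ => uniformAvg (S.K2 n) fun κ₂ => uniformAvg (S.xLen n) fun x =>
        T D n (κ₁ ++ (κ₂ ++ S.pay n (hashStr (S.t n * S.Lz n) (S.m1S n) κ₁ (S.zStr n (S.ρ n) x))
          (hashStr (S.xLen n) (S.m2S n) κ₂ x))) := by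
  unfold seedEnsembleI
  rw [acceptPMF_map_uniformBits_toReal, aP_eval, a, uniformAvg_append3]
  refine uniformAvg_congr fun κ₁ hκ₁ => uniformAvg_congr fun κ₂ hκ₂ => uniformAvg_congr fun x _ => ?_
  obtain ⟨h1, h2, h3⟩ := parse3 (w := x) hκ₁ hκ₂
  rw [T, candI_boolPair, cand, h1, h2, h3, S.rhoOf_kGood hS, S.jOf_kGood hS]
  simp only [pay, m1S, m2S, List.append_assoc]

/-- **The hybrids' acceptance probability** as an average over keys, the coins `R` and `u₂`. [cite: Goldreich2001, §3.2.3] -/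
theorem acc_X (D : RandAlg (List Bool) Bool) (i : ℕ → ℕ) (n : ℕ) :
    (acceptPMF D n (S.X i n) true).toReal =
      uniformAvg (S.K1 n) fun κ₁ => uniformAvg (S.K2 n) fun κ₂ => uniformAvg (S.rLen n) fun R => uniformAvg (S.m2S n) fun u₂ =>
        T D n (κ₁ ++ (κ₂ ++ S.pay n (hashStr (S.t n * S.Lz n) (S.m1S n) κ₁ (S.zH n (S.ρ n) (i n) R)) u₂)) := by
  unfold X
  rw [acceptPMF_map_uniformBits_toReal, Lh, uniformAvg_append4]
  refine uniformAvg_congr fun κ₁ hκ₁ => uniformAvg_congr fun κ₂ hκ₂ => uniformAvg_congr fun R hR =>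
    uniformAvg_congr fun u₂ hu₂ => ?_
  obtain ⟨h1, h2, h3⟩ := parse3 (w := R ++ u₂) hκ₁ hκ₂
  have h4 : ((κ₁ ++ κ₂ ++ (R ++ u₂)).drop (S.K1 n + S.K2 n)).take (S.rLen n) = R := by
    rw [h3, List.take_append_of_le_length hR.ge, List.take_of_length_le hR.le]
  have h5 : ((κ₁ ++ κ₂ ++ (R ++ u₂)).drop (S.K1 n + S.K2 n + S.rLen n)).take (S.m2S n) = u₂ := by
    rw [← List.drop_drop, h3, List.drop_append_of_le_length hR.ge, List.drop_of_length_le hR.le, List.nil_append,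
      List.take_of_length_le hu₂.le]
  rw [T, hybStr, List.append_assoc (κ₁ ++ κ₂) R u₂, h1, h2, h4, h5]

/-- **The uniform string's acceptance probability** split along the keys. [folklore] -/
theorem acc_unif (D : RandAlg (List Bool) Bool) (n : ℕ) :
    (acceptPMF D n (uniformBits (S.a n + 1)) true).toReal =
      uniformAvg (S.K1 n) fun κ₁ => uniformAvg (S.K2 n) fun κ₂ => uniformAvg (S.xLen n + 1) fun y => T D n (κ₁ ++ (κ₂ ++ y)) := by
  have h : uniformBits (S.a n + 1) = (uniformBits (S.K1 n + S.K2 n + (S.xLen n + 1))).map id := by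
    rw [PMF.map_id, show S.K1 n + S.K2 n + (S.xLen n + 1) = S.a n + 1 by unfold a; omega]
  rw [h, acceptPMF_map_uniformBits_toReal, uniformAvg_append3]
  refine uniformAvg_congr fun κ₁ _ => uniformAvg_congr fun κ₂ _ => uniformAvg_congr fun y _ => ?_
  simp only [T, id, List.append_assoc]

end Setup

end ComPRG

end Literature.Computability.Cryptography
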